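import Literature.Geometry.DiscreteGeometry.KissingCertComp

/-!
# Kernel-evaluable checker for three-point (Bachoc–Vallentin) certificates in any dimension

Framing: lottery ticket; floor = certified bounds/negative ranges. Venture `PackingBounds`
(cell `pub-packcert`), three-point SDP family.

The *computational* half of a certificate checker for the Bachoc–Vallentin semidefinite bound
(J. AMS 21 (2008), Theorem 4.2) for `A(n, arccos s)`, **general dimension `n ≥ 4` and rational
angle `s = p/q`**, symmetric ("sym", Machado–de Oliveira Filho 2018, Lemma 3.1) sums-of-squares
multipliers `1, q s₁, q² s₂, q³ s₃, s₄` (`g(x) = (x+1)(s-x)`, `s₁ = Σ g`, `s₂ = Σ gg`, `s₃ = ggg`,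
`s₄ = 1 + 2uvt - u² - v² - t²`). It generalises `Literature/…/KissingCertComp` (which is the case
`n = 4`, `s = 1/2`, Chebyshev/Legendre tables) and reuses its sparse trivariate integer polynomials
(`PolyCert.SPoly`: `normalize`, `mulN`, `mergeAll`, `residualBound`, Gram blocks `GramBlk`/`quadL`/
`chunkOK`, `FBlk`, `ofFlat`). Everything here is plain `List`/`ℤ`/`ℕ` programs run by the kernel
(`decide`); their meaning and the soundness theorem are in `ThreePointCert.Sound`.

Units (`D = 2^S`, `W = 2^d d!`, `M_k = W/(2^k k!)`): two-point part
`A(u) = Σ_k (A_k/D²) C_k^{(n-2)/2}(u)`, reflected as `AI = Σ_k A_k M_k GI_k` with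
`GI_k = 2^k k! C_k^{(n-2)/2}` (`gegTwoI`, integer three-term recurrence); three-point part
`F = (1/D²) Σ_k Σ_w sym6(φ_w(u) φ_w(v) Q n k)` reflected as `FI = Σ_k M_k Σ_w sym6(φ_w φ_w QI_k)`,
`QI_k = 2^k k! Q n k` (`QI`, integer recurrence; `Q n k` = `BachocVallentin.Q` of
`ThreePointKernelGeneral`); `b_ij = B_ij/(D² W)`. Checks: `(ii')`
`-B₂₂ - FI ≡ E₀ + m₁E₁ + m₂E₂ + m₃E₃ + s₄E₄ + c₀ (± residual ≤ c₀)`, `(i')`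
`-(D²W + 2B₁₂ + B₂₂) - AI(u) - 3FI(u,u,1) ≡ E_{Q0} + g_q(u) E_{Q1} + c₀₁ (± residual ≤ c₀₁)`, where the
`E`'s are validated Gram expansions `zᵀ(LLᵀ)z` over monomial lists; side conditions; and the bound
`D²W + AI(1) + B₁₁ + FI(1,1,1) < (N+1) D²W`.

## References
* C. Bachoc, F. Vallentin, J. Amer. Math. Soc. 21 (2008), Theorem 4.2. [`BachocVallentin2007`]
* F. C. Machado, F. M. de Oliveira Filho, Exp. Math. 27 (2018), Lemma 3.1 (symmetric SOS). [`MachadoDeOliveiraFilho2018`]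
-/

noncomputable section

namespace Summit.Ventures.PackingBounds.ThreePointCert

open Literature.Geometry.DiscreteGeometry Literature.Geometry.DiscreteGeometry.PolyCert
open Literature.Geometry.DiscreteGeometry.PolyCert.SPoly

/-! ### Gegenbauer tables by integer three-term recurrences -/

/-- `GI n k = 2^k k! · C_k^{(n-2)/2}(u)` as a term list in `u`:
`G₀ = 1`, `G₁ = (n-2)(2u)`, `G_{j+2} = (2j+n)(2u) G_{j+1} - 4(j+1)(j+n-2) G_j`. -/
def gegTwoI (n : ℕ) : ℕ → SPoly
  | 0 => C 1
  | 1 => smul (2 * ((n : ℤ) - 2)) U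
  | j + 2 => normalize (smul (2 * (2 * (j : ℤ) + n)) (mulN U (gegTwoI n (j + 1))) ++
      smul (-(4 * ((j : ℤ) + 1) * ((j : ℤ) + n - 2))) (gegTwoI n j))

/-- `σ = 2(t - uv)`. -/
def sigP : SPoly := [(⟨0, 0, 1⟩, 2), (⟨1, 1, 0⟩, -2)]

/-- `π = (1 - u²)(1 - v²)`. -/
def piP : SPoly := [(⟨0, 0, 0⟩, 1), (⟨2, 0, 0⟩, -1), (⟨0, 2, 0⟩, -1), (⟨2, 2, 0⟩, 1)]

/-- `QI n k = 2^k k! · Q n k (u,v,t)` (`Q n k = P^{(n-3)/2}_k(2(t-uv), (1-u²)(1-v²))`) as a term list: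
`Q₀ = 1`, `Q₁ = (n-3)σ`, `Q_{j+2} = (2j+n-1) σ Q_{j+1} - 4(j+1)(j+n-3) π Q_j`. -/
def QI (n : ℕ) : ℕ → SPoly
  | 0 => C 1
  | 1 => smul ((n : ℤ) - 3) sigP
  | j + 2 => normalize (smul (2 * (j : ℤ) + n - 1) (mulN sigP (QI n (j + 1))) ++
      smul (-(4 * ((j : ℤ) + 1) * ((j : ℤ) + n - 3))) (mulN piP (QI n j)))

/-- `M_k = W/(2^k k!) = 2^{d-k} · d!/k!` (for `k ≤ d`). -/
def Mfac (d k : ℕ) : ℕ := 2 ^ (d - k) * Nat.descFactorial d (d - k)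

/-- `W = 2^d d!`. -/
def Wfac (d : ℕ) : ℕ := 2 ^ d * Nat.factorial d

/-! ### The three-point part `FI` and the two-point part `AI` -/

/-- `u^a v^b QI n k` as a term list. -/
def baseTabG (n k a b : ℕ) : SPoly := normalize (mulN [(⟨a, b, 0⟩, 1)] (QI n k))

/-- `sym6 (u^a v^b QI n k)` as a term list. -/
def symTabG (n k a b : ℕ) : SPoly :=
  normalize (baseTabG n k a b ++ permBAC (baseTabG n k a b) ++ permACB (baseTabG n k a b) ++
    permCBA (baseTabG n k a b) ++ permCAB (baseTabG n k a b) ++ permBCA (baseTabG n k a b))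

/-- One weight vector: `Σ_{a,b} w_a w_b · symTabG n k a b`. -/
def FwPolyG (n k : ℕ) (w : List ℤ) : SPoly :=
  mergeAll ((List.range w.length).map fun a => mergeAll ((List.range w.length).map fun b' =>
    smul (w.getD a 0 * w.getD b' 0) (symTabG n k a b')))

/-- One block: `M_k · Σ_w FwPolyG`. -/
def FbPolyG (n d : ℕ) (b : FBlk) : SPoly := smul (Mfac d b.k : ℤ) (mergeAll (b.ws.map (FwPolyG n b.k)))

/-- Reflective form of `FI = Σ_blocks M_k Σ_w sym6(φ_w φ_w QI_k)`. -/
def FPolyG (n d : ℕ) (bs : List FBlk) : SPoly := mergeAll (bs.map (FbPolyG n d))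

/-- Reflective form of `AI = Σ_k A_k M_k GI_k`. -/
def APolyG (n d : ℕ) (A : List ℕ) : SPoly :=
  mergeAll ((List.range A.length).map fun k => smul ((A.getD k 0 : ℤ) * (Mfac d k : ℤ)) (gegTwoI n k))

/-! ### Multipliers for the angle `s = p/q` -/

/-- `g_q(u) = (u+1)(p - q u) = q · (u+1)(s-u)`. -/
def gqU (p : ℤ) (q : ℕ) : SPoly := [(⟨0, 0, 0⟩, p), (⟨1, 0, 0⟩, p - q), (⟨2, 0, 0⟩, -(q : ℤ))]

/-- `m₁ = q s₁ = g_q(u) + g_q(v) + g_q(t)`. -/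
def m1P (p : ℤ) (q : ℕ) : SPoly := normalize (gqU p q ++ permBAC (gqU p q) ++ permCBA (gqU p q))

/-- `m₂ = q² s₂ = g_q(u)g_q(v) + g_q(u)g_q(t) + g_q(v)g_q(t)`. -/
def m2P (p : ℤ) (q : ℕ) : SPoly :=
  normalize (mulN (gqU p q) (permBAC (gqU p q)) ++ mulN (gqU p q) (permCBA (gqU p q)) ++
    mulN (permBAC (gqU p q)) (permCBA (gqU p q)))

/-- `m₃ = q³ s₃ = g_q(u) g_q(v) g_q(t)`. -/
def m3P (p : ℤ) (q : ℕ) : SPoly :=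
  normalize (mulN (gqU p q) (mulN (permBAC (gqU p q)) (permCBA (gqU p q))))

/-! ### Certificates and checks -/

/-- A three-point certificate in integer units (see the module docstring). -/
structure Cert3 where
  /-- dimension -/
  n : ℕ
  /-- degree -/
  d : ℕ
  /-- numerator of the cosine `s = p/q` -/
  p : ℤ
  /-- denominator of `s` -/
  q : ℕ
  /-- binary scale `D = 2^S` of the two- and three-point data -/
  S : ℕ
  /-- the claimed integer bound -/
  N : ℕ
  /-- `A_0, …, A_d` (`a_k = A_k / D²`) -/
  A : List ℕ
  /-- `b₁₁ = B11/(D²W)` -/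
  B11 : ℕ
  /-- `b₁₂ = B12/(D²W)` -/
  B12 : ℤ
  /-- `b₂₂ = B22/(D²W)` -/
  B22 : ℕ
  /-- the three-point blocks (degree `k`, integer weight vectors) -/
  F : List FBlk
  /-- slack numerator of `(ii')` -/
  c0 : ℕ
  /-- slack numerator of `(i')` -/
  c01 : ℕ

/-- `D² W` for a certificate. -/
def Cert3.DDW (c : Cert3) : ℕ := 2 ^ (2 * c.S) * Wfac c.d

/-- The claimed expansions accompanying a certificate (validated separately). -/
structure CertPolys3 where
  /-- expansion of `FI` -/
  FP : SPoly
  /-- Gram expansions for the multipliers `1, m₁, m₂, m₃, s₄` of `(ii')` -/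
  E0 : SPoly
  /-- see `E0` -/
  E1 : SPoly
  /-- see `E0` -/
  E2 : SPoly
  /-- see `E0` -/
  E3 : SPoly
  /-- see `E0` -/
  E4 : SPoly
  /-- Gram expansions for the multipliers `1, g_q(u)` of `(i')` -/
  EQ0 : SPoly
  /-- see `EQ0` -/
  EQ1 : SPoly

/-- Validation of the `FI` expansion in one go. -/
def FexpOKG (c : Cert3) (FP : SPoly) : Bool := residualBound (FPolyG c.n c.d c.F ++ neg FP) 0

/-- Block-chunk check for `FI`: `Dprev + FPolyG bs - Dnext ≡ 0`. -/
def FchunkOKG (n d : ℕ) (bs : List FBlk) (Dprev Dnext : SPoly) : Bool :=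
  residualBound (Dprev ++ FPolyG n d bs ++ neg Dnext) 0

/-- Target of `(ii')`: `-(B22 + FI)`. -/
def targetII3 (c : Cert3) (P : CertPolys3) : SPoly := neg (C (c.B22 : ℤ) ++ P.FP)

/-- Sum-of-squares side of `(ii')`. -/
def rhsII3 (c : Cert3) (P : CertPolys3) : SPoly :=
  mergeAll [P.E0, mulN (m1P c.p c.q) P.E1, mulN (m2P c.p c.q) P.E2, mulN (m3P c.p c.q) P.E3, mulN p4 P.E4]

/-- The check of `(ii')`. -/
def checkII3 (c : Cert3) (P : CertPolys3) : Bool :=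
  residualBound (mergeAll [targetII3 c P, neg (rhsII3 c P), neg (C (c.c0 : ℤ))]) c.c0

/-- Target of `(i')`: `-(D²W + 2B12 + B22 + AI(u) + 3 FI(u,u,1))`. -/
def targetI3 (c : Cert3) (P : CertPolys3) : SPoly :=
  neg (C ((c.DDW : ℤ) + 2 * c.B12 + c.B22) ++ APolyG c.n c.d c.A ++ smul 3 (substUU1 P.FP))

/-- Sum-of-squares side of `(i')`. -/
def rhsI3 (c : Cert3) (P : CertPolys3) : SPoly := mergeAll [P.EQ0, mulN (gqU c.p c.q) P.EQ1]

/-- The check of `(i')`. -/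
def checkI3 (c : Cert3) (P : CertPolys3) : Bool :=
  residualBound (mergeAll [targetI3 c P, neg (rhsI3 c P), neg (C (c.c01 : ℤ))]) c.c01

/-- Side conditions: `n ≥ 4`, `0 < q`, `p ≤ q` (`s ≤ 1`), `-q ≤ p` (`-1 ≤ s`), `|A| = d+1`,
all blocks of degree `≤ d`, `B12² ≤ B11 B22`. -/
def checkSide3 (c : Cert3) : Bool :=
  decide (4 ≤ c.n) && decide (0 < c.q) && decide (c.p ≤ (c.q : ℤ)) && decide (-(c.q : ℤ) ≤ c.p) &&
    decide (c.A.length = c.d + 1) && (c.F.all fun b => decide (b.k ≤ c.d)) &&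
    decide (c.B12 * c.B12 ≤ (c.B11 : ℤ) * (c.B22 : ℤ))

/-- Integer test `0 ≤ D²W + AI(1) + B11 + FI(1,1,1) < (N+1) D²W`, using the expansion `FP`. -/
def checkBound3 (c : Cert3) (P : CertPolys3) : Bool :=
  decide ((c.DDW : ℤ) + coeffSum (APolyG c.n c.d c.A) + c.B11 + coeffSum P.FP < ((c.N : ℤ) + 1) * c.DDW) &&
  decide (0 ≤ (c.DDW : ℤ) + coeffSum (APolyG c.n c.d c.A) + c.B11 + coeffSum P.FP)

end Summit.Ventures.PackingBounds.ThreePointCert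

end
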